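import Summits.BirchSwinnertonDyer.BirchSwinnertonDyer.Theorems.AlignedTransportAtTwoMainConjectureOfRankZeroBSDAtTwoFineRoadArchNetting
import Summits.BirchSwinnertonDyer.BirchSwinnertonDyer.Theorems.AlignedTransportAtTwoMainConjectureOfRankZeroBSDAtTwoFineRoadQiCrux
import HarnessLib

/-!
# Route `AlignedTransportAtTwo`, crux C2 `MainConjectureOfRankZeroBSDAtTwo` (stmt-BirchSwinnertonDyer-22298):
# road (b″) netted at infinity WITH THE FINE SIDE UPSTAIRS over `ℚ(i)` — no fine descent, no narrow class group

HONEST FRAMING (cell `bsd-f1-sign2`, WIDTH-5 attached prover seat `bsd-line-att-p3` gen 3, line `birth` of the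
lead `bsd-line-att-p2`; BSD is NOT proved by any of this). THEOREMS ONLY; nothing asserted. Companion of
`…FineRoadArchNetting`. There the archimedean netting (`a + b = 2^e·s·G₊` against `e ≤ ℓ_{(2)}(ker(X^{rel} ↠ X))`)
left the fine side as the bare term `ℓ_{(2)}(X₀(E/K_∞)_Δ)`, `K_∞ = ℚ(ζ_{2^∞})`. The lead's ARCH-NETTING note
pays for the relaxed descent with a NARROW classical `μ₂ = 0` of the point field (statement (A) for the
relaxed-at-`∞` fine Selmer group over the totally real `ℚ_∞`). This file records the cheaper bookkeeping: do
not descend the fine side at all. `X₀(E/K_∞)_Δ` is a quotient of `X₀(E/K_∞)`, whose `(2)`-length as a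
`Λ₀`-module vanishes under statement (A) at `2` for the `ℚ(i)`-model of `E` (`Sel₀(K_∞, E[2^∞])[2]` finite;
`K_∞` is totally imaginary, so no archimedean condition exists upstairs) — the displayed Prop A₂′
`ConjAQiSeedsAtTwo` of the skeleton's road (b′), which follows from Lim 2017 Thm. 3.5 over `ℚ(i)` (totally
imaginary fields only: `L = ℚ(e₁, i)` of `2`-power index in `ℚ(i)(E[4])`) + Iwasawa's `μ₂ = 0` for the SEXTIC
`ℚ(e₁, i)` (att-p5 g3's PFμ(i); equivalent to skeleton v6's PFμ⁺ for `F = ℚ(E[2], ζ₄) ⊇ ℚ(e₁, i)` modulo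
Iwasawa 1973 along the totally imaginary quadratic extension `F/ℚ(e₁, i)`, finitely many ramified places up the
tower). CORRECTION of this header's first version (p601402): the ascent «wide `μ₂(ℚ(e₁)) = 0` ⟹ `μ₂(ℚ(e₁, i)) = 0`»
is NOT Iwasawa 1973 for free — the `2ⁿ·r₁` real places of `ℚ(e₁)_n` ramify in `ℚ(e₁, i)_n`; it holds when
`Δ_W < 0` (`r₁ = 1`: the units of `ℚ_n` realise every signature, so `Cl⁺ = Cl` up the tower — att-p5 g3, crux note
NARROW-A2.md; all certified seeds have `Δ_W < 0`) and is OPEN for `Δ_W > 0` (`r₁ = 3`), where `μ₂(ℚ(e₁, i)) = 0` is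
the narrow statement (REF1 §62 (S2)). None of these inputs is typed over `ℚ(i)` in the tree; all displayed.

* §0 `lengthAt_le_of_coinvDatum_netting_coker` (the netting lemma with `ℓ(Λ₀²/col P)` DISPLAYED instead of
  finite — at the anomalous prime `2` Prop. 17.11's cokernel is only claimed `(2)`-length-free) and
  `lengthAt_pi_quotient_augIdealP` / `natCast_le_lengthAt_of_injective` (`ℓ_{(p)}((Λ₀/p)^n) = n`; an embedding
  `(Λ₀/p)^n ↪ ker q` discharges `n ≤ ℓ(ker q)` — the typed shape of Greenberg L. 4.6 at `2`); used in
  `selmerDual_mu_eq_zero_of_roadB2_netting_structural_two` (§1), the per-datum theorem in witness shape.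
* §1 `selmerDual_mu_eq_zero_of_roadB2_netting_numberField_two` — per cyclotomic datum: the netted road-(b″)
  data with `Y'` = the dual fine Selmer module of a model `V` of `E` over a number field `K` (its `Δ`-action
  `cY` displayed) + statement (A) at `2` for `V/K` + `red G₊ ≠ 0` ⟹ `μ(X(E/ℚ_∞)) = 0`.
* §2 `seedMuZeroAtTwo_of_fineRoadNettingQi` / `mainConjectureOfRankZeroBSDAtTwo_of_fineRoadNettingQi` — stub T
  and C2 BY NAME from PRINT {modularity} + the DISPLAYED netted data over `ℚ(i)` (K₂ⁿᵉᵗ′: a quadratic field of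
  discriminant `−4`, a `K`-model, a cyclotomic datum over `K` with its dual fine Selmer datum `YdK`, Kato's row
  `P → X' → YdK.X → 0` with `Δ`-action, injective `Δ`-equivariant Coleman map with finite cokernel, zeta images
  with `a + b = 2^e·s·G₊`, relaxed descent `fd : X'_Δ → X^{rel}` with finite cokernel, archimedean extension
  `q : X^{rel} ↠ X(W/ℚ_∞)` with `e ≤ ℓ_{(2)}(ker q)`) + (A₂′) statement (A) at `2` over `ℚ(i)` for the seeds.
  CONDITIONAL; the item stays open; the `∃`-data certify no provenance (att-p3 g2 `…CoinvDataJunk`).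

References: K. Kato, Astérisque 295 (2004), Thm. 17.4 (1), Prop. 17.11, §17.13; R. Greenberg, LNM 1716 (1999),
Lemma 4.6 and pp. 98–99; J. Coates, R. Sujatha, Math. Ann. 331 (2005) §3 (statement (A), Thm. 3.4); M. F. Lim,
Asian J. Math. 21 (2017) Thm. 3.5; K. Iwasawa, *On the `μ`-invariants of `ℤ_ℓ`-extensions*, in: Number theory,
algebraic geometry and commutative algebra in honor of Y. Akizuki (Kinokuniya, Tokyo 1973) 1–11.
-/

set_option linter.dupNamespace false
set_option autoImplicit false

noncomputable section

open scoped Classical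

open Literature.NumberTheory.EllipticCurves Literature.NumberTheory.EllipticCurves.Module

namespace Summit.BirchSwinnertonDyer.BirchSwinnertonDyer.Theorems.AlignedTransportAtTwoFineRoad

/-! ## §0 Two supplements to the netting lemma: the Coleman cokernel displayed, and `ℓ_{(p)}((Λ₀/p)^n) = n` -/

section Supplements

variable (p : ℕ) [Fact p.Prime]
  {P X' Y' Xr XD : Type*} [AddCommGroup P] [_root_.Module (IwasawaAlgebra p) P]
  [AddCommGroup X'] [_root_.Module (IwasawaAlgebra p) X']
  [AddCommGroup Y'] [_root_.Module (IwasawaAlgebra p) Y']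
  [AddCommGroup Xr] [_root_.Module (IwasawaAlgebra p) Xr]
  [AddCommGroup XD] [_root_.Module (IwasawaAlgebra p) XD]

/-- **The netting lemma with the Coleman cokernel DISPLAYED** (no finiteness asked of `Λ₀²/col(P)`; at an
anomalous prime — every good ordinary `2` is anomalous, `#Ẽ(𝔽₂) ∈ {2, 4}` — Prop. 17.11's cokernel need not be
finite, only of `(p)`-length `0`, which is what this form lets the typer audit):
`ℓ_{(p)}(X_D) ≤ ℓ_{(p)}(Λ₀²/col P) + ℓ_{(p)}(Λ₀/(G)) + ℓ_{(p)}(Y'_Δ)` under the hypotheses of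
`lengthAt_le_of_coinvDatum_netting` minus `hfin`. [cite: Kato2004Asterisque, Prop. 17.11 (p. 277) and §17.13 (pp. 279–280)]
[cite: GreenbergLNM1716, Lemma 4.6 and pp. 98–99] -/
theorem lengthAt_le_of_coinvDatum_netting_coker (𝔭 : PrimeSpectrum (IwasawaAlgebra p))
    (h𝔭 : 𝔭.asIdeal = IwasawaAlgebra.augIdealP p)
    (toX : P →ₗ[IwasawaAlgebra p] X') (π : X' →ₗ[IwasawaAlgebra p] Y') (hX : Function.Exact toX π)
    (hπ : Function.Surjective π) (cP : P →ₗ[IwasawaAlgebra p] P) (cX : X' →ₗ[IwasawaAlgebra p] X')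
    (cY : Y' →ₗ[IwasawaAlgebra p] Y') (hcX : toX ∘ₗ cP = cX ∘ₗ toX) (hcY : π ∘ₗ cX = cY ∘ₗ π)
    (col : P →ₗ[IwasawaAlgebra p] IwasawaAlgebra p × IwasawaAlgebra p) (hcol : Function.Injective col)
    (hccol : col ∘ₗ cP = (LinearEquiv.prodComm (IwasawaAlgebra p) (IwasawaAlgebra p) (IwasawaAlgebra p) :
      IwasawaAlgebra p × IwasawaAlgebra p →ₗ[IwasawaAlgebra p] IwasawaAlgebra p × IwasawaAlgebra p) ∘ₗ col)
    {w₁ w₂ : P} (h₁ : toX w₁ = 0) (h₂ : toX w₂ = 0) {a b s G : IwasawaAlgebra p} {e : ℕ}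
    (hw₁ : col w₁ = (a, b)) (hw₂ : col w₂ = (b, a)) (hs : s ∉ IwasawaAlgebra.augIdealP p)
    (hab : a + b = PowerSeries.C ((p : ℤ_[p]) ^ e) * s * G)
    (fd : (X' ⧸ LinearMap.range (cX - 1)) →ₗ[IwasawaAlgebra p] Xr) (hfd : Finite (Xr ⧸ LinearMap.range fd))
    (q : Xr →ₗ[IwasawaAlgebra p] XD) (hq : Function.Surjective q)
    (he : (e : ℕ∞) ≤ lengthAt (IwasawaAlgebra p) (LinearMap.ker q) 𝔭) :
    lengthAt (IwasawaAlgebra p) XD 𝔭 ≤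
      lengthAt (IwasawaAlgebra p) ((IwasawaAlgebra p × IwasawaAlgebra p) ⧸ LinearMap.range col) 𝔭 +
        lengthAt (IwasawaAlgebra p) (IwasawaAlgebra p ⧸ Ideal.span {G}) 𝔭 +
          lengthAt (IwasawaAlgebra p) (Y' ⧸ LinearMap.range (cY - 1)) 𝔭 := by
  haveI := hfd
  have h1 := lengthAt_coinv_le_of_roadB2 toX π hX hπ cP cX cY hcX hcY col hcol hccol h₁ h₂ hw₁ hw₂ 𝔭
  rw [hab, lengthAt_quotient_span_C_pow_mul_mul p e hs G 𝔭 h𝔭] at h1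
  have h2 : lengthAt (IwasawaAlgebra p) Xr 𝔭 ≤
      lengthAt (IwasawaAlgebra p) (X' ⧸ LinearMap.range (cX - 1)) 𝔭 := by
    rw [lengthAt_eq_add_quotient (LinearMap.range fd) 𝔭,
      lengthAt_augIdealP_eq_zero_of_finite p (Xr ⧸ LinearMap.range fd) 𝔭 h𝔭, add_zero]
    exact lengthAt_le_of_surjective fd.rangeRestrict fd.surjective_rangeRestrict 𝔭
  have h3 : (e : ℕ∞) + lengthAt (IwasawaAlgebra p) XD 𝔭 ≤ lengthAt (IwasawaAlgebra p) Xr 𝔭 := by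
    rw [lengthAt_eq_add_quotient (LinearMap.ker q) 𝔭,
      lengthAt_eq_of_linearEquiv (q.quotKerEquivOfSurjective hq) 𝔭]
    exact add_le_add he le_rfl
  have h4 := h3.trans (h2.trans h1)
  have hre : lengthAt (IwasawaAlgebra p) ((IwasawaAlgebra p × IwasawaAlgebra p) ⧸ LinearMap.range col) 𝔭 +
      ((e : ℕ∞) + lengthAt (IwasawaAlgebra p) (IwasawaAlgebra p ⧸ Ideal.span {G}) 𝔭) +
        lengthAt (IwasawaAlgebra p) (Y' ⧸ LinearMap.range (cY - 1)) 𝔭 =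
      (e : ℕ∞) + (lengthAt (IwasawaAlgebra p) ((IwasawaAlgebra p × IwasawaAlgebra p) ⧸ LinearMap.range col) 𝔭 +
        lengthAt (IwasawaAlgebra p) (IwasawaAlgebra p ⧸ Ideal.span {G}) 𝔭 +
          lengthAt (IwasawaAlgebra p) (Y' ⧸ LinearMap.range (cY - 1)) 𝔭) := by
    abel
  rw [hre] at h4
  exact (ENat.add_le_add_iff_left (ENat.coe_ne_top e)).mp h4

/-- `ℓ_{(p)}((Λ₀/(p))^n) = n`: each factor localises to the residue field of `Λ₀,(p)`. [folklore] -/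
theorem lengthAt_pi_quotient_augIdealP (n : ℕ) (𝔭 : PrimeSpectrum (IwasawaAlgebra p))
    (h𝔭 : 𝔭.asIdeal = IwasawaAlgebra.augIdealP p) :
    lengthAt (IwasawaAlgebra p) (Fin n → IwasawaAlgebra p ⧸ IwasawaAlgebra.augIdealP p) 𝔭 = n := by
  obtain ⟨I, hI⟩ := 𝔭
  subst h𝔭
  rw [lengthAt_pi (IwasawaAlgebra p) ⟨IwasawaAlgebra.augIdealP p, hI⟩
    (fun _ : Fin n => IwasawaAlgebra p ⧸ IwasawaAlgebra.augIdealP p)]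
  have h1 : lengthAt (IwasawaAlgebra p) (IwasawaAlgebra p ⧸ IwasawaAlgebra.augIdealP p)
      ⟨IwasawaAlgebra.augIdealP p, hI⟩ = 1 :=
    lengthAt_quotient_self (⟨IwasawaAlgebra.augIdealP p, hI⟩ : PrimeSpectrum (IwasawaAlgebra p))
  simp [h1]

/-- **Discharging `e ≤ ℓ_{(p)}(ker q)` structurally**: an embedding `(Λ₀/(p))^n ↪ M` gives `n ≤ ℓ_{(p)}(M)`. At
`p = 2` this is how Greenberg's archimedean `Λ/2Λ ⊆ ker(X^{rel∞}(E/ℚ_∞) ↠ X^{str})` (for `E[2] ⊂ E(ℝ)`, i.e.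
`Δ_E > 0`) feeds the netting lemma with `n = e = 1`. [cite: GreenbergLNM1716, Lemma 4.6 and pp. 98–99] -/
theorem natCast_le_lengthAt_of_injective (n : ℕ) (𝔭 : PrimeSpectrum (IwasawaAlgebra p))
    (h𝔭 : 𝔭.asIdeal = IwasawaAlgebra.augIdealP p) {M : Type*} [AddCommGroup M]
    [_root_.Module (IwasawaAlgebra p) M]
    (ι : (Fin n → IwasawaAlgebra p ⧸ IwasawaAlgebra.augIdealP p) →ₗ[IwasawaAlgebra p] M)
    (hι : Function.Injective ι) : (n : ℕ∞) ≤ lengthAt (IwasawaAlgebra p) M 𝔭 := by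
  rw [← lengthAt_pi_quotient_augIdealP p n 𝔭 h𝔭]
  exact lengthAt_le_of_injective ι hι 𝔭

end Supplements

/-! ## §1 Per cyclotomic datum, fine side upstairs -/

section AtTwo

open WeierstrassCurve Summit.BirchSwinnertonDyer.Rank1Residual.X1.MuLambda

variable (W : WeierstrassCurve ℚ) {κ : ZpExtension ℚ 2} {γ : Field.absoluteGaloisGroup ℚ}

/-- **Netted road (b″), fine side UPSTAIRS over a number field.** As `selmerDual_mu_eq_zero_of_roadB2_netting_two`
with `Y'` = the dual fine Selmer module `X₀(V/K_∞)` (`YdK.X`) of a model `V` of `E` over a number field `K`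
(for road (b″): `K = ℚ(i)`, `K_∞ = ℚ(ζ_{2^∞})`; `cY` its `Δ`-action, displayed) and the fine input = statement
(A) at `2` for `V/K` (`Sel₀(K_∞, V[2^∞])[2]` finite): then `ℓ_{(2)}(Y'_Δ) ≤ ℓ_{(2)}(Y') = 0`, so the
even-branch analytic `μ₂ = 0` (`red G₊ ≠ 0`) gives `μ(X(E/ℚ_∞)) = 0`. No descent on the fine side, no
archimedean place upstairs (`K_∞` totally imaginary), hence no narrow class group in the A-input.
[cite: Kato2004Asterisque, Thm. 17.4 (1) (p. 273), Prop. 17.11 (p. 277), §17.13 (pp. 279–280)]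
[cite: GreenbergLNM1716, Lemma 4.6 and pp. 98–99] [cite: CoatesSujatha2005, statement (A) (§3)] -/
theorem selmerDual_mu_eq_zero_of_roadB2_netting_numberField_two (D : W.SelmerDualData κ γ)
    {K : Type} [Field K] [NumberField K] (V : WeierstrassCurve K) {κK : ZpExtension K 2}
    {γK : Field.absoluteGaloisGroup K} (hγK : κK.IsTopGenerator γK) (YdK : V.FineSelmerDualData κK γK)
    (hAK : Set.Finite {s : V.fineSelmerInfty κK | 2 • s = 0}) {G : IwasawaAlgebra 2} (hred : red G ≠ 0)
    {P X' Xr : Type*} [AddCommGroup P] [_root_.Module (IwasawaAlgebra 2) P]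
    [AddCommGroup X'] [_root_.Module (IwasawaAlgebra 2) X']
    [AddCommGroup Xr] [_root_.Module (IwasawaAlgebra 2) Xr]
    (toX : P →ₗ[IwasawaAlgebra 2] X') (π : X' →ₗ[IwasawaAlgebra 2] YdK.X) (hX : Function.Exact toX π)
    (hπ : Function.Surjective π) (cP : P →ₗ[IwasawaAlgebra 2] P) (cX : X' →ₗ[IwasawaAlgebra 2] X')
    (cY : YdK.X →ₗ[IwasawaAlgebra 2] YdK.X) (hcX : toX ∘ₗ cP = cX ∘ₗ toX) (hcY : π ∘ₗ cX = cY ∘ₗ π)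
    (col : P →ₗ[IwasawaAlgebra 2] IwasawaAlgebra 2 × IwasawaAlgebra 2) (hcol : Function.Injective col)
    (hccol : col ∘ₗ cP = (LinearEquiv.prodComm (IwasawaAlgebra 2) (IwasawaAlgebra 2) (IwasawaAlgebra 2) :
      IwasawaAlgebra 2 × IwasawaAlgebra 2 →ₗ[IwasawaAlgebra 2] IwasawaAlgebra 2 × IwasawaAlgebra 2) ∘ₗ col)
    (hfin : Finite ((IwasawaAlgebra 2 × IwasawaAlgebra 2) ⧸ LinearMap.range col))
    {w₁ w₂ : P} (h₁ : toX w₁ = 0) (h₂ : toX w₂ = 0) {a b s : IwasawaAlgebra 2} {e : ℕ} (hw₁ : col w₁ = (a, b))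
    (hw₂ : col w₂ = (b, a)) (hs : s ∉ IwasawaAlgebra.augIdealP 2)
    (hab : a + b = PowerSeries.C ((2 : ℤ_[2]) ^ e) * s * G)
    (fd : (X' ⧸ LinearMap.range (cX - 1)) →ₗ[IwasawaAlgebra 2] Xr) (hfd : Finite (Xr ⧸ LinearMap.range fd))
    (q : Xr →ₗ[IwasawaAlgebra 2] D.X) (hq : Function.Surjective q)
    (he : (e : ℕ∞) ≤ lengthAt (IwasawaAlgebra 2) (LinearMap.ker q)
      ⟨IwasawaAlgebra.augIdealP 2, IwasawaAlgebra.isPrime_augIdealP_holds 2⟩) : D.mu = 0 := by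
  let 𝔭 : PrimeSpectrum (IwasawaAlgebra 2) :=
    ⟨IwasawaAlgebra.augIdealP 2, IwasawaAlgebra.isPrime_augIdealP_holds 2⟩
  have hY : lengthAt (IwasawaAlgebra 2) YdK.X 𝔭 = 0 :=
    lengthAt_fineSelmerDual_eq_zero_of_finite_twoTorsion_numberField V hγK YdK hAK
  have hA : lengthAt (IwasawaAlgebra 2) (YdK.X ⧸ LinearMap.range (cY - 1)) 𝔭 = 0 :=
    nonpos_iff_eq_zero.mp (hY ▸ lengthAt_quotient_le (LinearMap.range (cY - 1)) 𝔭)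
  exact selmerDual_mu_eq_zero_of_roadB2_netting_two W D hred toX π hX hπ cP cX cY hcX hcY col hcol hccol hfin
    h₁ h₂ hw₁ hw₂ hs hab fd hfd q hq he hA

/-- **Netted road (b″) in STRUCTURAL form** — the shape a typed witness would instantiate: the Coleman cokernel
enters through its `(2)`-length (`= 0`: Prop. 17.11 at the anomalous prime `2`, displayed), the archimedean input
as an EMBEDDING `(Λ₀/2)^e ↪ ker(X^{rel} ↠ X(E/ℚ_∞))` (Greenberg L. 4.6 at `2` with `e = [Δ_E > 0]`), the unit
equation as `a + b = 2^e·s·G₊` (REF1 §57), the fine input as `ℓ_{(2)}(Y'_Δ) = 0`; with `red G₊ ≠ 0` they give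
`μ(X(E/ℚ_∞)) = 0`. [cite: Kato2004Asterisque, Thm. 17.4 (1) (p. 273), Prop. 17.11 (p. 277), §17.13 (pp. 279–280)]
[cite: GreenbergLNM1716, Lemma 4.6 and pp. 98–99] -/
theorem selmerDual_mu_eq_zero_of_roadB2_netting_structural_two (D : W.SelmerDualData κ γ)
    {G : IwasawaAlgebra 2} (hred : red G ≠ 0)
    {P X' Y' Xr : Type*} [AddCommGroup P] [_root_.Module (IwasawaAlgebra 2) P]
    [AddCommGroup X'] [_root_.Module (IwasawaAlgebra 2) X']
    [AddCommGroup Y'] [_root_.Module (IwasawaAlgebra 2) Y']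
    [AddCommGroup Xr] [_root_.Module (IwasawaAlgebra 2) Xr]
    (toX : P →ₗ[IwasawaAlgebra 2] X') (π : X' →ₗ[IwasawaAlgebra 2] Y') (hX : Function.Exact toX π)
    (hπ : Function.Surjective π) (cP : P →ₗ[IwasawaAlgebra 2] P) (cX : X' →ₗ[IwasawaAlgebra 2] X')
    (cY : Y' →ₗ[IwasawaAlgebra 2] Y') (hcX : toX ∘ₗ cP = cX ∘ₗ toX) (hcY : π ∘ₗ cX = cY ∘ₗ π)
    (col : P →ₗ[IwasawaAlgebra 2] IwasawaAlgebra 2 × IwasawaAlgebra 2) (hcol : Function.Injective col)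
    (hccol : col ∘ₗ cP = (LinearEquiv.prodComm (IwasawaAlgebra 2) (IwasawaAlgebra 2) (IwasawaAlgebra 2) :
      IwasawaAlgebra 2 × IwasawaAlgebra 2 →ₗ[IwasawaAlgebra 2] IwasawaAlgebra 2 × IwasawaAlgebra 2) ∘ₗ col)
    (hcoker : lengthAt (IwasawaAlgebra 2) ((IwasawaAlgebra 2 × IwasawaAlgebra 2) ⧸ LinearMap.range col)
      ⟨IwasawaAlgebra.augIdealP 2, IwasawaAlgebra.isPrime_augIdealP_holds 2⟩ = 0)
    {w₁ w₂ : P} (h₁ : toX w₁ = 0) (h₂ : toX w₂ = 0) {a b s : IwasawaAlgebra 2} {e : ℕ} (hw₁ : col w₁ = (a, b))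
    (hw₂ : col w₂ = (b, a)) (hs : s ∉ IwasawaAlgebra.augIdealP 2)
    (hab : a + b = PowerSeries.C ((2 : ℤ_[2]) ^ e) * s * G)
    (fd : (X' ⧸ LinearMap.range (cX - 1)) →ₗ[IwasawaAlgebra 2] Xr) (hfd : Finite (Xr ⧸ LinearMap.range fd))
    (q : Xr →ₗ[IwasawaAlgebra 2] D.X) (hq : Function.Surjective q)
    (ι : (Fin e → IwasawaAlgebra 2 ⧸ IwasawaAlgebra.augIdealP 2) →ₗ[IwasawaAlgebra 2] LinearMap.ker q)
    (hι : Function.Injective ι)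
    (hA : lengthAt (IwasawaAlgebra 2) (Y' ⧸ LinearMap.range (cY - 1))
      ⟨IwasawaAlgebra.augIdealP 2, IwasawaAlgebra.isPrime_augIdealP_holds 2⟩ = 0) : D.mu = 0 := by
  let 𝔭 : PrimeSpectrum (IwasawaAlgebra 2) :=
    ⟨IwasawaAlgebra.augIdealP 2, IwasawaAlgebra.isPrime_augIdealP_holds 2⟩
  have he : (e : ℕ∞) ≤ lengthAt (IwasawaAlgebra 2) (LinearMap.ker q) 𝔭 :=
    natCast_le_lengthAt_of_injective 2 e 𝔭 rfl ι hι
  have h := lengthAt_le_of_coinvDatum_netting_coker 2 𝔭 rfl toX π hX hπ cP cX cY hcX hcY col hcol hccol h₁ h₂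
    hw₁ hw₂ hs (by exact_mod_cast hab) fd hfd q hq he
  have hq0 : lengthAt (IwasawaAlgebra 2) (IwasawaAlgebra 2 ⧸ Ideal.span {G}) 𝔭 = 0 :=
    lengthAt_quotient_eq_zero_of_not_le
      (by rw [Ideal.span_singleton_le_iff_mem]; exact not_mem_augIdealP_of_red_ne_zero hred)
  have hc' : lengthAt (IwasawaAlgebra 2) ((IwasawaAlgebra 2 × IwasawaAlgebra 2) ⧸ LinearMap.range col) 𝔭 = 0 :=
    hcoker
  have hA' : lengthAt (IwasawaAlgebra 2) (Y' ⧸ LinearMap.range (cY - 1)) 𝔭 = 0 := hA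
  rw [hc', hq0, hA', add_zero, add_zero] at h
  have hX0 : lengthAt (IwasawaAlgebra 2) D.X 𝔭 = 0 := nonpos_iff_eq_zero.mp h
  change muInvariant 2 D.X = 0
  rw [muInvariant_eq_toNat_lengthAt 2 D.X 𝔭 rfl, hX0]
  rfl

end AtTwo

/-! ## §2 The crux on the netted road with the fine side over `ℚ(i)` -/

section Crux

open CongruenceSubgroup WeierstrassCurve Literature.NumberTheory.EllipticCurves.ModularForms
  Literature.NumberTheory.EllipticCurves.Greenberg1999
  Literature.NumberTheory.EllipticCurves.Rank1Residual
  Literature.NumberTheory.IwasawaTheory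
  Summit.BirchSwinnertonDyer.Rank1Residual Summit.BirchSwinnertonDyer.Rank1Residual.X1.MuLambda
  Summit.BirchSwinnertonDyer.Rank1Residual.X5 Summit.BirchSwinnertonDyer.Rank1Residual.F1Sign2
  Summit.BirchSwinnertonDyer.BirchSwinnertonDyer.Theorems.Rank1ResidualX1Defs
  Summit.BirchSwinnertonDyer.BirchSwinnertonDyer.Theses.AlignedTransportAtTwo

/-- **Stub T of line `birth` on the NETTED road (b″) with the fine side over `ℚ(i)` (K₂ⁿᵉᵗ′ + A₂′).**
Modularity + for every seed-cell curve and cyclotomic datum the DISPLAYED netted data over `ℚ(i)` (a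
quadratic field `K` of discriminant `−4`, a `K`-model `V'` of `W`, a cyclotomic datum `(κK, γK)` over `K` with
its dual fine Selmer datum `YdK`, Kato's row `P → X' → YdK.X → 0` over `ℚ(ζ_{2^∞})` with `Δ`-action, injective
`Δ`-equivariant Coleman map with finite cokernel, zeta images with `a + b = 2^e·s·G₊` for SOME `e`, a relaxed
descent `fd : X'_Δ → X^{rel}` with finite cokernel, an archimedean extension `q : X^{rel} ↠ X(W/ℚ_∞)` with
`e ≤ ℓ_{(2)}(ker q)`; nothing asserted) + (A₂′) statement (A) at `2` for the `ℚ(i)`-models of the seeds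
⟹ `SeedMuZeroAtTwo`. No descent and no class group on the fine side beyond (A₂′).
[cite: Kato2004Asterisque, Thm. 17.4 (1), Prop. 17.11, §17.13 (pp. 273–280)] [cite: GreenbergLNM1716, Lemma 4.6 and pp. 98–99]
[cite: CoatesSujatha2005, statement (A) (§3) and Thm. 3.4] -/
theorem seedMuZeroAtTwo_of_fineRoadNettingQi (hmod : nonempty_modularParametrizationData)
    (hK2nK : ∀ (W : WeierstrassCurve ℚ) [W.IsElliptic] [W.IsGloballyMinimal], IsOrdinaryAt W 2 →
      (∀ x : ℚ, ¬ HasRationalTwoTorsionX W x) →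
      ∀ (κ : ZpExtension ℚ 2) (γ : Field.absoluteGaloisGroup ℚ), κ.IsCyclotomic →
      κ.IsTopGenerator γ → IsCyclotomicVariable 2 γ →
      ∀ ⦃N : ℕ⦄ [NeZero N] (f : CuspForm (Gamma0 N) 2), IsNewformOf W f →
      ∀ Gp : IwasawaAlgebra 2, iwasawaToPowerSeries 2 Gp = padicLFunction f (unitRoot W 2 : ℚ_[2]) →
      ∀ D : W.SelmerDualData κ γ,
        ∃ (K : Type) (_ : Field K) (_ : NumberField K) (V' : WeierstrassCurve K)
          (κK : ZpExtension K 2) (γK : Field.absoluteGaloisGroup K) (YdK : V'.FineSelmerDualData κK γK)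
          (P X' Xr : Type) (_ : AddCommGroup P) (_ : _root_.Module (IwasawaAlgebra 2) P)
          (_ : AddCommGroup X') (_ : _root_.Module (IwasawaAlgebra 2) X')
          (_ : AddCommGroup Xr) (_ : _root_.Module (IwasawaAlgebra 2) Xr)
          (toX : P →ₗ[IwasawaAlgebra 2] X') (π : X' →ₗ[IwasawaAlgebra 2] YdK.X)
          (cP : P →ₗ[IwasawaAlgebra 2] P) (cX : X' →ₗ[IwasawaAlgebra 2] X')
          (cY : YdK.X →ₗ[IwasawaAlgebra 2] YdK.X)
          (col : P →ₗ[IwasawaAlgebra 2] IwasawaAlgebra 2 × IwasawaAlgebra 2) (w₁ w₂ : P)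
          (a b s : IwasawaAlgebra 2) (e : ℕ) (fd : (X' ⧸ LinearMap.range (cX - 1)) →ₗ[IwasawaAlgebra 2] Xr)
          (q : Xr →ₗ[IwasawaAlgebra 2] D.X),
          Module.finrank ℚ K = 2 ∧ NumberField.discr K = -4 ∧
          (∃ C : VariableChange K, C • W.baseChange K = V') ∧ κK.IsCyclotomic ∧ κK.IsTopGenerator γK ∧
          Function.Exact toX π ∧ Function.Surjective π ∧ toX ∘ₗ cP = cX ∘ₗ toX ∧ π ∘ₗ cX = cY ∘ₗ π ∧
          Function.Injective col ∧
          col ∘ₗ cP = (LinearEquiv.prodComm (IwasawaAlgebra 2) (IwasawaAlgebra 2) (IwasawaAlgebra 2) :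
            IwasawaAlgebra 2 × IwasawaAlgebra 2 →ₗ[IwasawaAlgebra 2]
              IwasawaAlgebra 2 × IwasawaAlgebra 2) ∘ₗ col ∧
          Finite ((IwasawaAlgebra 2 × IwasawaAlgebra 2) ⧸ LinearMap.range col) ∧
          toX w₁ = 0 ∧ toX w₂ = 0 ∧ col w₁ = (a, b) ∧ col w₂ = (b, a) ∧
          s ∉ IwasawaAlgebra.augIdealP 2 ∧ a + b = PowerSeries.C ((2 : ℤ_[2]) ^ e) * s * Gp ∧
          Finite (Xr ⧸ LinearMap.range fd) ∧ Function.Surjective q ∧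
          (e : ℕ∞) ≤ lengthAt (IwasawaAlgebra 2) (LinearMap.ker q)
              ⟨IwasawaAlgebra.augIdealP 2, IwasawaAlgebra.isPrime_augIdealP_holds 2⟩)
    (hA2K : ∀ (W : WeierstrassCurve ℚ) [W.IsElliptic] [W.IsGloballyMinimal], ¬ W.HasCM →
      IsOrdinaryAt W 2 → (∀ x : ℚ, ¬ HasRationalTwoTorsionX W x) → ¬ IsSquare W.Δ →
      W.analyticRank = 0 → BSDp W 2 →
      ∀ (K : Type) [Field K] [NumberField K] (V' : WeierstrassCurve K),
        Module.finrank ℚ K = 2 → NumberField.discr K = -4 →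
        (∃ C : VariableChange K, C • W.baseChange K = V') →
        ∀ κK : ZpExtension K 2, κK.IsCyclotomic → Set.Finite {s : V'.fineSelmerInfty κK | 2 • s = 0}) :
    ∀ (W : WeierstrassCurve ℚ) [W.IsElliptic] [W.IsGloballyMinimal], ¬ W.HasCM →
      IsOrdinaryAt W 2 → (∀ x : ℚ, ¬ HasRationalTwoTorsionX W x) → ¬ IsSquare W.Δ →
      W.analyticRank = 0 →
      (∀ ⦃N : ℕ⦄ [NeZero N] (f : CuspForm (Gamma0 N) 2), IsNewformOf W f →
        ∀ G : IwasawaAlgebra 2, IsEvenBranchLiftAtTwo W f G → red G ≠ 0) →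
      BSDp W 2 →
      ∀ (κ : ZpExtension ℚ 2) (γ : Field.absoluteGaloisGroup ℚ), κ.IsCyclotomic →
        κ.IsTopGenerator γ → IsCyclotomicVariable 2 γ →
        ∀ D : W.SelmerDualData κ γ, D.IsTorsion → D.mu = 0 := by
  intro W _ _ hcm hord ht hsq hr hμan hbsd κ γ hκ hγ hγ' D _
  have hirr : Irr W 2 := AlignedTransportAtTwoSeed.irr_two_of_forall_not_hasRationalTwoTorsionX W ht
  haveI : NeZero (W.conductorNorm ℤ) := ⟨(W.conductorNorm_pos_holds).ne'⟩
  obtain ⟨Dm⟩ := hmod W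
  obtain ⟨Gp, hGp⟩ := exists_iwasawaToPowerSeries_eq_padicLFunction_two hord Dm.isNewformOf hirr
  have hred : red Gp ≠ 0 := hμan Dm.f Dm.isNewformOf Gp (Or.inl ⟨hord, hGp⟩)
  obtain ⟨K, _, _, V', κK, γK, YdK, P, X', Xr, _, _, _, _, _, _, toX, π, cP, cX, cY, col, w₁, w₂, a, b, s, e,
    fd, q, hK2, hK4, hV', hκK, hγK, hX, hπ, hcX, hcY, hcol, hccol, hfin, h₁, h₂, hw₁, hw₂, hs, hab, hfd, hq,
    he⟩ := hK2nK W hord ht κ γ hκ hγ hγ' Dm.f Dm.isNewformOf Gp hGp D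
  have hA := hA2K W hcm hord ht hsq hr hbsd K V' hK2 hK4 hV' κK hκK
  exact selmerDual_mu_eq_zero_of_roadB2_netting_numberField_two W D V' hγK YdK hA hred toX π hX hπ cP cX cY
    hcX hcY col hcol hccol hfin h₁ h₂ hw₁ hw₂ hs hab fd hfd q hq he

/-- **C2 BY NAME on the netted road (b″) with the fine side over `ℚ(i)`.** PRINT {Kato 17.4 (1)(2) at `2`,
Greenberg 4.1, period unit, modularity, GZK} + (K₂ⁿᵉᵗ′) + (A₂′) ⟹ `MainConjectureOfRankZeroBSDAtTwo`.
CONDITIONAL: the item stays open ((A₂′) ⟸ Lim 2017 over `ℚ(i)` + Iwasawa 1973 + Iwasawa's `μ₂ = 0` for the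
`S₃`-cubic `ℚ(e₁)` — the last OPEN class-wide; (K₂ⁿᵉᵗ′) awaits typing: Greenberg L. 4.6 at `2`, inf–res for
the relaxed descent, Kato's row over `ℚ(ζ_{2^∞})` with its `Δ`-action).
[cite: Kato2004Asterisque, Thm. 17.4 (p. 273) and §17.13 (pp. 279–280)] [cite: GreenbergLNM1716, Thm. 4.1 (p. 102), Lemma 4.6 and Conj. 1.11 (p. 58)]
[cite: CoatesSujatha2005, statement (A) (§3) and Thm. 3.4] -/
theorem mainConjectureOfRankZeroBSDAtTwo_of_fineRoadNettingQi
    (h17 : ∀ (V : WeierstrassCurve ℚ) [V.IsElliptic] [V.IsGloballyMinimal] [NeZero (V.conductorNorm ℤ)]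
      (f : CuspForm (Gamma0 (V.conductorNorm ℤ)) 2), kato_divisibility_allPrimes V 2 (f := f))
    (hGr : Greenberg1999.thm41_charValue_rankZero_anyPrime)
    (hper : realPeriodRat_eq_unit_mul_plusPeriod_two) (hmod : nonempty_modularParametrizationData)
    (hGZK : rank_eq_analyticRank_of_analyticRank_le_one)
    (hK2nK : ∀ (W : WeierstrassCurve ℚ) [W.IsElliptic] [W.IsGloballyMinimal], IsOrdinaryAt W 2 →
      (∀ x : ℚ, ¬ HasRationalTwoTorsionX W x) →
      ∀ (κ : ZpExtension ℚ 2) (γ : Field.absoluteGaloisGroup ℚ), κ.IsCyclotomic →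
      κ.IsTopGenerator γ → IsCyclotomicVariable 2 γ →
      ∀ ⦃N : ℕ⦄ [NeZero N] (f : CuspForm (Gamma0 N) 2), IsNewformOf W f →
      ∀ Gp : IwasawaAlgebra 2, iwasawaToPowerSeries 2 Gp = padicLFunction f (unitRoot W 2 : ℚ_[2]) →
      ∀ D : W.SelmerDualData κ γ,
        ∃ (K : Type) (_ : Field K) (_ : NumberField K) (V' : WeierstrassCurve K)
          (κK : ZpExtension K 2) (γK : Field.absoluteGaloisGroup K) (YdK : V'.FineSelmerDualData κK γK)
          (P X' Xr : Type) (_ : AddCommGroup P) (_ : _root_.Module (IwasawaAlgebra 2) P)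
          (_ : AddCommGroup X') (_ : _root_.Module (IwasawaAlgebra 2) X')
          (_ : AddCommGroup Xr) (_ : _root_.Module (IwasawaAlgebra 2) Xr)
          (toX : P →ₗ[IwasawaAlgebra 2] X') (π : X' →ₗ[IwasawaAlgebra 2] YdK.X)
          (cP : P →ₗ[IwasawaAlgebra 2] P) (cX : X' →ₗ[IwasawaAlgebra 2] X')
          (cY : YdK.X →ₗ[IwasawaAlgebra 2] YdK.X)
          (col : P →ₗ[IwasawaAlgebra 2] IwasawaAlgebra 2 × IwasawaAlgebra 2) (w₁ w₂ : P)
          (a b s : IwasawaAlgebra 2) (e : ℕ) (fd : (X' ⧸ LinearMap.range (cX - 1)) →ₗ[IwasawaAlgebra 2] Xr)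
          (q : Xr →ₗ[IwasawaAlgebra 2] D.X),
          Module.finrank ℚ K = 2 ∧ NumberField.discr K = -4 ∧
          (∃ C : VariableChange K, C • W.baseChange K = V') ∧ κK.IsCyclotomic ∧ κK.IsTopGenerator γK ∧
          Function.Exact toX π ∧ Function.Surjective π ∧ toX ∘ₗ cP = cX ∘ₗ toX ∧ π ∘ₗ cX = cY ∘ₗ π ∧
          Function.Injective col ∧
          col ∘ₗ cP = (LinearEquiv.prodComm (IwasawaAlgebra 2) (IwasawaAlgebra 2) (IwasawaAlgebra 2) :
            IwasawaAlgebra 2 × IwasawaAlgebra 2 →ₗ[IwasawaAlgebra 2]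
              IwasawaAlgebra 2 × IwasawaAlgebra 2) ∘ₗ col ∧
          Finite ((IwasawaAlgebra 2 × IwasawaAlgebra 2) ⧸ LinearMap.range col) ∧
          toX w₁ = 0 ∧ toX w₂ = 0 ∧ col w₁ = (a, b) ∧ col w₂ = (b, a) ∧
          s ∉ IwasawaAlgebra.augIdealP 2 ∧ a + b = PowerSeries.C ((2 : ℤ_[2]) ^ e) * s * Gp ∧
          Finite (Xr ⧸ LinearMap.range fd) ∧ Function.Surjective q ∧
          (e : ℕ∞) ≤ lengthAt (IwasawaAlgebra 2) (LinearMap.ker q)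
              ⟨IwasawaAlgebra.augIdealP 2, IwasawaAlgebra.isPrime_augIdealP_holds 2⟩)
    (hA2K : ∀ (W : WeierstrassCurve ℚ) [W.IsElliptic] [W.IsGloballyMinimal], ¬ W.HasCM →
      IsOrdinaryAt W 2 → (∀ x : ℚ, ¬ HasRationalTwoTorsionX W x) → ¬ IsSquare W.Δ →
      W.analyticRank = 0 → BSDp W 2 →
      ∀ (K : Type) [Field K] [NumberField K] (V' : WeierstrassCurve K),
        Module.finrank ℚ K = 2 → NumberField.discr K = -4 →
        (∃ C : VariableChange K, C • W.baseChange K = V') →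
        ∀ κK : ZpExtension K 2, κK.IsCyclotomic → Set.Finite {s : V'.fineSelmerInfty κK | 2 • s = 0}) :
    MainConjectureOfRankZeroBSDAtTwo :=
  AlignedTransportAtTwoSeed.mainConjectureOfRankZeroBSDAtTwo_of_seedMuZero h17 hGr hper hmod hGZK
    (seedMuZeroAtTwo_of_fineRoadNettingQi hmod hK2nK hA2K)

end Crux

end Summit.BirchSwinnertonDyer.BirchSwinnertonDyer.Theorems.AlignedTransportAtTwoFineRoad

end
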